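import Summits.ABC.IUTFork.ForkGenuineDepthRankOne
import Summits.ABC.IUTFork.LDHGenuinePerImageShallow
import HarnessLib

/-!
# The fork at [IUTchIII] Corollary 3.12 at a GENUINE input: over `F₀ = K = ℚ` the typed inequality is decided for
# EVERY input — it is EXACTLY the shallow condition `κ_l·deĝ̲(𝔮) ≤ ((l+5)/4)·log π` (skeleton XXVIIe-c)

Record-only file (D-0012) of the abc-iut cell (deliverable (a), skeleton seat abc-iut-skel, gen 9); TAKES NO SIDE.
Sequel to `ForkGenuineDepthRankOne.lean` (XXVIIe, p444412: on a rank-one packet every (Ind2) element is a unit scalar, so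
(Ind2) and the hull fix `c·(R_I)^∼` at EVERY prime) and to `ForkGenuineRegimes.lean` (XXVIIc, p425602: at every genuine input
`κ_l·deĝ̲(𝔮) ≤ ((l+5)/4)·log π ⟹ Cor312Of I`, `κ_l = (l+1)/24 − 1/(2l)`, by the free inequality alone). HERE, for EVERY
Θ-volume input `I : ThetaVolumeInput ℚ ℚ` — any pilot data `(j_E ∈ ℚ, S, l)`, ANY ideles in the genuine completions `ℚ_p`:

* `iota_smul_normalizedPacket_eq_zpow_smul_of_finrank_eq_one` (packet algebra): a slot element `t` of a LINE `k_a` with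
  `‖t‖ = p^{−n}` moves the integral structure to `p^n·(R_I)^∼` (`t = p^n·w·1`, `‖w‖ = 1`);
* `realPrimePacketWith_negLogThetaAt_eq_of_norm_of_finrank_eq_one` — rank-one primes, ideles given by their NORMS `‖t_{i,v}‖ = p^{−n_i}`:
  `−|log(Θ)|_p = (1/ℓ⋇)·Σ_i (−n_i·log p)` exactly (the norm form of XXVIIe's scalar law);
* **`negLogThetaLoc_rat_eq`** — at every prime `p`, with `v` the place of `ℚ` over `p`:
  `negLogThetaLoc I p = −(1/ℓ⋇)·Σ_i deĝ̲(P_{Θ,i}(v)·[v]) = (1/ℓ⋇)·Σ_i (−P_{Θ,i}(v)·log p)` — the BARE value, no inflation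
  (`ramIdx_rat_eq_one`, `logNorm_rat_eq`: `e_v = f_v = 1`, so `ord_v(t) = n` iff `‖t‖ = p^{−n}`);
* **`negLogThetaNonarch_rat_eq`** — `negLogThetaNonarch I = −deĝ̲_lgp(P_Θ)` EXACTLY (abc-iut-S2's free inequality
  `DHData.free_inequality_input` is an EQUALITY over `ℚ/ℚ`; summed via c312-3's `DHData.sum_sum_placesOver_of`);
* **`cor312Of_rat_iff`** — `Cor312Of I ↔ deĝ̲_lgp(P_Θ) − deĝ̲(P_q) ≤ ((l+5)/4)·log π ↔ κ_l·deĝ̲(𝔮) ≤ ((l+5)/4)·log π`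
  (`cor312Of_rat_iff_kappa`): XXVIIc's SHALLOW sufficient condition is NECESSARY over `ℚ/ℚ`; equivalently
  (`cor312Of_rat_iff_deg_le`) `deĝ̲(𝔮) ≤ (6l(l+5)/(l²+l−12))·log π`, and since `6l(l+5)/(l²+l−12) ≤ 50/3` for `l ≥ 5`:
  **`not_cor312Of_rat_of_lt`** — EVERY input over `ℚ/ℚ` with `deĝ̲(𝔮) = Σ_{v∈S} ord_v(q_v)·log p_v > (50/3)·log π`
  (`≈ 19.08`, i.e. `Π_{v∈S} p_v^{ord_v(q_v)} > π^{50/3} ≈ 1.9·10⁸`) has `¬ Cor312Of I`, whatever `l`.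

READING (grammar of `HOME/skel/FORK-REAL-MODEL.md` §4/§11; no side taken): §4 reads the typed inequality in the sharp real model as
«gap `κ_l·deĝ̲(𝔮)` ≤ ramification budget + `((l+5)/4)·log π`»; over `ℚ/ℚ` the budget is ZERO at every prime (rank-one packets,
XXVIIe), so the typed [IUTchIII] Cor. 3.12 at such an input carries no room beyond the archimedean constant: it is TRUE exactly
in the shallow window and FALSE beyond it — whatever could make it hold at genuine data of large height must come from the
ramification of `K = F(E_F[l])`. HONEST SCOPE: inhabitants of abc-iut-S2's INPUT TYPE over `ℚ/ℚ`, NOT initial Θ-data of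
[IUTchI] Def. 3.1 (`√−1 ∈ F ⊆ K`, Def. 3.1 (a): `K` is never `ℚ`); sharp (Ind3), full (Ind1)/(Ind2), Mochizuki's container.
Nothing here bears on whether [IUTchIII] Thm. 3.11 licenses Cor. 3.12; typed ≠ proved. PROOF-ONLY file: no definitions, no `Prop` facts.
[cite: Mochizuki2012, IUTchIV Thm. 1.10 Step (vi) p. 29, Step (vii) p. 30] [cite: DupuyHilado2025, §1 (1.1), Def. 3.6.3, §3.3, §3.9,
Thm. 3.10.1, §4.9–4.12] [cite: Mochizuki2012, IUTchIII Cor. 3.12 p. 173–174] [claim: Mochizuki2012, status: disputed]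
-/

noncomputable section

open Set Module Literature.IUT.LogVolume Literature.NumberTheory.NumberFields NumberField IsDedekindDomain
open scoped Pointwise

namespace Summit.ABC.IUTFork.GenuineContent

/-! ## §1 Packet algebra: a slot element of a LINE, given by its norm -/

section RankOneNorm

variable (p : ℕ) [Fact p.Prime] {ι : Type} [Fintype ι] [DecidableEq ι] [Nonempty ι]
variable (k : ι → Type) [∀ i, NontriviallyNormedField (k i)] [∀ i, NormedAlgebra ℚ_[p] (k i)]
  [∀ i, IsUltrametricDist (k i)] [∀ i, ProperSpace (k i)]

omit [Fintype ι] [DecidableEq ι] [Nonempty ι] [∀ i, IsUltrametricDist (k i)] [∀ i, ProperSpace (k i)] in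
/-- On a line `k_a` over `ℚ_p` every element is a rational scalar: `t = x·1`, `x ∈ ℚ_p`. [cite: DupuyHilado2025, Def. 3.6.1] -/
theorem exists_eq_algebraMap_of_finrank_eq_one (a : ι) (h1 : finrank ℚ_[p] (k a) = 1) (t : k a) :
    ∃ x : ℚ_[p], t = algebraMap ℚ_[p] (k a) x := by
  obtain ⟨x, hx⟩ := (finrank_eq_one_iff_of_nonzero' (1 : k a) one_ne_zero).mp h1 t
  exact ⟨x, by rw [← hx, Algebra.smul_def, mul_one]⟩

omit [Fintype ι] [Nonempty ι] [∀ i, IsUltrametricDist (k i)] [∀ i, ProperSpace (k i)] in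
/-- **A slot element of a LINE with `‖t‖ = p^{−n}` moves `(R_I)^∼` to `p^n·(R_I)^∼`**: `t = x·1` with `x = p^n·w ∈ ℚ_p`,
`‖w‖ = 1`, and a unit does not move the integral structure. [cite: Mochizuki2012, IUTchIV Thm. 1.10 Step (v) p. 27, Step (vi) p. 29]
[cite: DupuyHilado2025, §3.7, §3.9] -/
theorem iota_smul_normalizedPacket_eq_zpow_smul_of_finrank_eq_one (a : ι) (h1 : finrank ℚ_[p] (k a) = 1)
    (t : k a) (n : ℤ) (ht : ‖t‖ = (p : ℝ) ^ (-n)) :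
    iota p k a t • (normalizedPacket p k : Set (PacketAlgebra p k)) =
      ((p : ℚ_[p]) ^ n) • (normalizedPacket p k : Set (PacketAlgebra p k)) := by
  obtain ⟨x, rfl⟩ := exists_eq_algebraMap_of_finrank_eq_one p k a h1 t
  have hp0 : (p : ℚ_[p]) ≠ 0 := Nat.cast_ne_zero.mpr (Fact.out : p.Prime).ne_zero
  have hp0' : (p : ℝ) ≠ 0 := Nat.cast_ne_zero.mpr (Fact.out : p.Prime).ne_zero
  rw [norm_algebraMap'] at ht
  obtain ⟨w, hw_def⟩ : ∃ w : ℚ_[p], w = x * (p : ℚ_[p]) ^ (-n) := ⟨_, rfl⟩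
  have hw : ‖w‖ = 1 := by
    rw [hw_def, norm_mul, norm_zpow, Padic.norm_p, ht, inv_zpow', neg_neg, ← zpow_add₀ hp0',
      neg_add_cancel, zpow_zero]
  have hxw : x = (p : ℚ_[p]) ^ n * w := by
    rw [hw_def, mul_left_comm, ← zpow_add₀ hp0, add_neg_cancel, zpow_zero, mul_one]
  have hwO : w • (normalizedPacket p k : Set (PacketAlgebra p k)) = normalizedPacket p k := by
    rw [smul_set_eq_algebraMap_smul, ← (iota p k a).commutes w]
    exact iota_smul_normalizedPacket_eq_of_norm_eq_one p k a (by rw [norm_algebraMap', hw])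
  rw [(iota p k a).commutes x, ← smul_set_eq_algebraMap_smul, hxw, ← smul_smul, hwO]

end RankOneNorm

/-! ## §2 A Θ-idele at a prime of rank-one completions, given by its norms: `−|log(Θ)|_p` exactly -/

section Norm

variable {F : Type} [Field F] [NumberField F]
variable (p : ℕ) [hp : Fact p.Prime] (𝔽 : LocalFields F p)
variable (c : (j : ℕ) → (Fin (j + 1) → placesOver F p) → ℚ_[p]) (hc0 : ∀ j e, c j e ≠ 0)
  (hcσ : ∀ (j : ℕ) (σ : Equiv.Perm (Fin (j + 1))) (e : Fin (j + 1) → placesOver F p), c j (e ∘ σ) = c j e)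

/-- **ZERO INFLATION at a prime of RANK-ONE completions, norm form** (real packet, ANY shell scalar, ANY prime): if every `K_v`
(`v | p`) is a line over `ℚ_p` and `‖t_{i,v}‖ = p^{−n_i}` for all `v | p`, then `−|log(Θ)|_p = (1/ℓ⋇)·Σ_i (−n_i·log p)` — every
slot region is `p^{n_i}·(R_{v⃗})^∼` (§1), their union and its (Ind2)-orbit and hull are `p^{n_i}·(R_{v⃗})^∼` (XXVIIe), of
log-volume `−n_i·log p`. [cite: Mochizuki2012, IUTchIV Thm. 1.10 Step (vi) p. 29] [cite: DupuyHilado2025, Def. 3.6.3, §4.11–4.12]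
[claim: Mochizuki2012, status: disputed] -/
theorem realPrimePacketWith_negLogThetaAt_eq_of_norm_of_finrank_eq_one
    (h1 : ∀ v : placesOver F p, finrank ℚ_[p] (𝔽.k v) = 1) {lstar : ℕ}
    (t : Fin lstar → (v : placesOver F p) → (𝔽.k v)ˣ) (n : Fin lstar → ℤ)
    (ht : ∀ (i : Fin lstar) (v : placesOver F p), ‖(t i v : 𝔽.k v)‖ = (p : ℝ) ^ (-(n i))) :
    (realPrimePacketWith p 𝔽 c hc0 hcσ).negLogThetaAt lstar t =
      (1 / (lstar : ℝ)) * ∑ i : Fin lstar, -((n i : ℝ) * Real.log p) := by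
  classical
  have hsum : ∑ v : placesOver F p, weight F v.1 = 1 := (localWeights F p).sum_pr
  have hW : ∀ m : ℕ, ∑ e : Fin m → placesOver F p, ∏ b, weight F (e b).1 = 1 := by
    intro m
    have h := Finset.prod_univ_sum (t := fun _ : Fin m => (Finset.univ : Finset (placesOver F p)))
      (f := fun _ v => weight F v.1)
    rw [Fintype.piFinset_univ] at h
    rw [← h, hsum, Finset.prod_const_one]
  have hval : ∀ (i : Fin lstar) (e : Fin ((i : ℕ) + 1 + 1) → placesOver F p),
      (realPrimePacketWith p 𝔽 c hc0 hcσ).logμ ((realPrimePacketWith p 𝔽 c hc0 hcσ).possibleImagesHull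
        ((realPrimePacketWith p 𝔽 c hc0 hcσ).pilotRegion t) ((i : ℕ) + 1) e) = -((n i : ℝ) * Real.log p) := by
    intro i e
    have hslots : (⋃ a : Fin ((i : ℕ) + 1 + 1), iota p (fun b => 𝔽.k (e b)) a (t i (e a) : 𝔽.k (e a)) •
          (normalizedPacket p (fun b => 𝔽.k (e b)) : Set (PacketAlgebra p (fun b => 𝔽.k (e b))))) =
        ((p : ℚ_[p]) ^ n i) • (normalizedPacket p (fun b => 𝔽.k (e b)) : Set (PacketAlgebra p (fun b => 𝔽.k (e b)))) := by
      rw [Set.iUnion_congr fun a => iota_smul_normalizedPacket_eq_zpow_smul_of_finrank_eq_one p (fun b => 𝔽.k (e b)) a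
        (h1 (e a)) _ (n i) (ht i (e a)), Set.iUnion_const]
    change packetLogμ p (fun b => 𝔽.k (e b)) (packetHull p (fun b => 𝔽.k (e b))
      ((realPrimePacketWith p 𝔽 c hc0 hcσ).possibleImages
        ((realPrimePacketWith p 𝔽 c hc0 hcσ).pilotRegion t) ((i : ℕ) + 1) e)) = _
    rw [realPrimePacketWith_possibleImages_pilotRegion_eq p 𝔽 c hc0 hcσ t i e, hslots,
      iUnion_indTwo_smul_smul_normalizedPacket_eq_of_finrank_eq_one p (fun b => 𝔽.k (e b)) (fun b => h1 (e b)) _,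
      ← ppow_smul_set_eq, packetHull_smul_normalizedPacket,
      packetLogμ_ppow_smul p _ _ (packetAdm_normalizedPacket p _), packetLogμ_normalizedPacket, add_zero]
  unfold PrimePacket.negLogThetaAt PrimePacket.lnνLp PrimePacket.lnνTensorPower
  refine congrArg (fun x : ℝ => (1 / (lstar : ℝ)) * x) (Finset.sum_congr rfl fun i _ => ?_)
  rw [Finset.sum_congr rfl fun e _ => by rw [hval i e], ← Finset.mul_sum, hW, mul_one]

end Norm

/-! ## §3 Over `ℚ/ℚ`, EVERY input: the bare value at every prime, `−|log(Θ)|^nonarch = −deĝ̲_lgp(P_Θ)` exactly -/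

section RatInputs

/-- Every finite place of `ℚ` has `e_v = 1` (and `f_v = 1`): `e_v·f_v = n_v = 1`. [cite: NeukirchANT1999, Ch. II Prop. (8.5)] -/
theorem ramIdx_rat_eq_one (w : HeightOneSpectrum (𝓞 ℚ)) : ramIdx ℚ w = 1 := by
  have h : ramIdx ℚ w * resDeg ℚ w = 1 := by
    rw [← localDegree, ← localDeg_eq_localDegree]; exact localDeg_rat_eq_one w
  exact Nat.eq_one_of_mul_eq_one_right h

/-- Every finite place of `ℚ` has `f_v = 1`. [cite: NeukirchANT1999, Ch. II Prop. (8.5)] -/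
theorem resDeg_rat_eq_one (w : HeightOneSpectrum (𝓞 ℚ)) : resDeg ℚ w = 1 := by
  have h : ramIdx ℚ w * resDeg ℚ w = 1 := by
    rw [← localDegree, ← localDeg_eq_localDegree]; exact localDeg_rat_eq_one w
  exact Nat.eq_one_of_mul_eq_one_left h

/-- `ln|κ(v)| = log p` for the place `v` of `ℚ` over `p`. [cite: DupuyHilado2025, §2.5.4] -/
theorem logNorm_rat_eq {p : ℕ} [Fact p.Prime] (v : placesOver ℚ p) : logNorm ℚ v.1 = Real.log p := by
  rw [logNorm_eq, resDeg_rat_eq_one, (mem_placesOver_iff_residueChar v.1).mp v.2]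
  simp

variable (I : ThetaVolumeInput ℚ ℚ)

/-- **The norms of the Θ-idele over `ℚ/ℚ`**: at a prime `p` there is ONE integer `n_i` with `‖t_{Θ,i,v}‖ = p^{−n_i}` for the place
`v | p`, and `n_i = P_{Θ,i}(v)` (`ord_v(t) = −e_v·log‖t‖/log p` with `e_v = 1`). [cite: DupuyHilado2025, §2.4.2, §3.4, §3.9] -/
theorem exists_norm_tΘ_rat_eq (p : ℕ) [hp : Fact p.Prime] (i : Fin I.lstar) :
    ∃ n : ℤ, ∀ v : placesOver ℚ p,
      ‖(I.tΘ p hp.out i v : (I.σ.localFieldFamily p hp.out).k v)‖ = (p : ℝ) ^ (-n) ∧ (n : ℝ) = I.X.thetaPilot i v.1 := by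
  obtain ⟨v₀, hv₀⟩ := placesOver_nonempty ℚ p
  obtain ⟨x, hx⟩ := exists_eq_algebraMap_of_finrank_eq_one p (fun v => (I.σ.localFieldFamily p hp.out).k v) ⟨v₀, hv₀⟩
    (finrank_localFields_rat_eq_one I.σ p ⟨v₀, hv₀⟩) (I.tΘ p hp.out i ⟨v₀, hv₀⟩ : (I.σ.localFieldFamily p hp.out).k ⟨v₀, hv₀⟩)
  have hx0 : x ≠ 0 := by
    intro h
    rw [h, map_zero] at hx
    exact (I.tΘ p hp.out i ⟨v₀, hv₀⟩).ne_zero hx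
  have hnorm : ‖(I.tΘ p hp.out i ⟨v₀, hv₀⟩ : (I.σ.localFieldFamily p hp.out).k ⟨v₀, hv₀⟩)‖ = (p : ℝ) ^ (-x.valuation) := by
    rw [hx, norm_algebraMap']
    exact Padic.norm_eq_zpow_neg_valuation hx0
  refine ⟨x.valuation, fun v => ?_⟩
  obtain rfl : v = ⟨v₀, hv₀⟩ := ValLine.placesOver_subsingleton_of_finrank_eq_one (Module.finrank_self ℚ) p v ⟨v₀, hv₀⟩
  refine ⟨hnorm, ?_⟩
  have hord := I.tΘ_ord p hp.out i ⟨v₀, hv₀⟩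
  rw [LocalFields.ordv, hnorm, ramIdx_rat_eq_one, Real.log_zpow] at hord
  have hlogp : Real.log p ≠ 0 :=
    Real.log_ne_zero_of_pos_of_ne_one (by exact_mod_cast hp.out.pos) (by exact_mod_cast hp.out.one_lt.ne')
  rw [← hord]
  field_simp
  push_cast
  ring

/-- **Over `ℚ/ℚ` the summand of `−|log(Θ)|` at EVERY prime is the BARE value** — for every input `I` and prime `p`:
`negLogThetaLoc I p = −(1/ℓ⋇)·Σ_i deĝ̲(Σ_{v|p} P_{Θ,i}(v)·[v])` (`= (1/ℓ⋇)·Σ_i (−P_{Θ,i}(v_p)·log p)`): NO (Ind1)/(Ind2)/hull inflation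
(rank-one packets, XXVIIe) — Dupuy–Hilado's Thm. 3.10.1 value of the BARE region `O_𝕃(−P_Θ)_p`.
[cite: Mochizuki2012, IUTchIV Thm. 1.10 Step (vi) p. 29] [cite: DupuyHilado2025, Def. 3.6.3, Thm. 3.10.1, §4.11–4.12]
[claim: Mochizuki2012, status: disputed] -/
theorem negLogThetaLoc_rat_eq (p : ℕ) [hp : Fact p.Prime] :
    I.negLogThetaLoc p = -(1 / (I.lstar : ℝ)) *
      ∑ i : Fin I.lstar, FinDivisor.ndeg ℚ (∑ v : placesOver ℚ p, FinDivisor.of v.1 (I.X.thetaPilot i v.1)) := by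
  classical
  obtain ⟨v₀, hv₀⟩ := placesOver_nonempty ℚ p
  choose n hn using fun i => exists_norm_tΘ_rat_eq I p i
  rw [I.negLogThetaLoc_of_prime hp.out]
  have h := realPrimePacketWith_negLogThetaAt_eq_of_norm_of_finrank_eq_one p (I.σ.localFieldFamily p hp.out)
    (mScale p (I.σ.localFieldFamily p hp.out)) (mScale_ne_zero p (I.σ.localFieldFamily p hp.out))
    (mScale_perm p (I.σ.localFieldFamily p hp.out)) (fun v => finrank_localFields_rat_eq_one I.σ p v)
    (I.tΘ p hp.out) n (fun i v => (hn i v).1)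
  refine h.trans ?_
  rw [neg_mul, ← mul_neg, ← Finset.sum_neg_distrib]
  refine congrArg (fun x : ℝ => (1 / (I.lstar : ℝ)) * x) (Finset.sum_congr rfl fun i _ => ?_)
  rw [Fintype.sum_eq_single (⟨v₀, hv₀⟩ : placesOver ℚ p) fun v hv =>
      absurd (ValLine.placesOver_subsingleton_of_finrank_eq_one (Module.finrank_self ℚ) p v ⟨v₀, hv₀⟩) hv,
    FinDivisor.ndeg_of, logNorm_rat_eq, Module.finrank_self, ← (hn i ⟨v₀, hv₀⟩).2]
  simp

/-- **Over `ℚ/ℚ`, `−|log(Θ)|^nonarch = −deĝ̲_lgp(P_Θ)` EXACTLY, for every input**: abc-iut-S2's free inequality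
`−deĝ̲_lgp(P_Θ) ≤ negLogThetaNonarch I` (`DHData.free_inequality_input`) is an equality — the indeterminacies and the hull add
nothing at any prime. [cite: DupuyHilado2025, §1 (1.1), Thm. 3.10.1, §4.10–4.12] [claim: Mochizuki2012, status: disputed] -/
theorem negLogThetaNonarch_rat_eq : I.negLogThetaNonarch = -LgpDivisor.ndegLgp I.X.thetaPilot := by
  classical
  have hT : ∀ p ∈ I.supportPrimes, p.Prime := fun _ hp => I.prime_of_mem_supportPrimes hp
  have hdec : ∀ i : Fin I.lstar,
      (∑ p ∈ I.supportPrimes, ∑ v : placesOver ℚ p, FinDivisor.of v.1 (I.X.thetaPilot i v.1)) = I.X.thetaPilot i :=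
    fun i => DHData.sum_sum_placesOver_of (I.X.thetaPilot i) I.supportPrimes hT fun v hv =>
      I.residueChar_mem_supportPrimes (by
        by_contra hS
        exact hv (PilotData.thetaPilot_apply_of_not_mem I.X i hS))
  unfold ThetaVolumeInput.negLogThetaNonarch LgpDivisor.ndegLgp
  rw [Finset.sum_congr rfl fun p hp => by
      haveI : Fact p.Prime := ⟨hT p hp⟩
      exact negLogThetaLoc_rat_eq I p,
    ← Finset.mul_sum, Finset.sum_comm, neg_mul]
  congr 2
  refine Finset.sum_congr rfl fun i _ => ?_
  rw [← map_sum, hdec i]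

/-- **`−|log(Θ)|` over `ℚ/ℚ`, every input**: `negLogTheta I = −deĝ̲_lgp(P_Θ) + ((l+5)/4)·log π`.
[cite: Mochizuki2012, IUTchIV Thm. 1.10 Step (vii) p. 30] [claim: Mochizuki2012, status: disputed] -/
theorem negLogTheta_rat_eq :
    I.negLogTheta = -LgpDivisor.ndegLgp I.X.thetaPilot + ThetaVolumeInput.archLogTheta I.l := by
  unfold ThetaVolumeInput.negLogTheta
  rw [negLogThetaNonarch_rat_eq]

/-! ## §4 Over `ℚ/ℚ`, EVERY input: the typed Cor. 3.12 is EXACTLY the shallow condition -/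

/-- **[IUTchIII] Cor. 3.12 FOR AN INPUT OVER `ℚ/ℚ` ⟺ the gap fits in the archimedean term**: for every `I : ThetaVolumeInput ℚ ℚ`,
`Cor312Of I ↔ deĝ̲_lgp(P_Θ) − deĝ̲(P_q) ≤ ((l+5)/4)·log π`. HYPOTHESIS-shaped on the left; synthetic inputs; no side taken.
[cite: Mochizuki2012, IUTchIII Cor. 3.12 p. 173–174] [cite: Mochizuki2012, IUTchIV Thm. 1.10 Step (vii) p. 30] [claim: Mochizuki2012, status: disputed] -/
theorem cor312Of_rat_iff :
    I.Cor312Of ↔ LgpDivisor.ndegLgp I.X.thetaPilot - FinDivisor.ndeg ℚ I.X.qPilot ≤ ThetaVolumeInput.archLogTheta I.l := by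
  unfold ThetaVolumeInput.Cor312Of ThetaVolumeInput.negAbsLogQ
  rw [negLogTheta_rat_eq]
  constructor <;> intro h <;> linarith

/-- **… ⟺ the SHALLOW condition of XXVIIc**: `Cor312Of I ↔ ((l+1)/24 − 1/(2l))·deĝ̲(𝔮) ≤ ((l+5)/4)·log π` — over `ℚ/ℚ` the
sufficient condition `cor312Of_of_shallow` (p425602) is also NECESSARY. [cite: Mochizuki2012, IUTchIII Cor. 3.12 p. 173–174]
[cite: DupuyHilado2025, §3.3] [claim: Mochizuki2012, status: disputed] -/
theorem cor312Of_rat_iff_kappa :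
    I.Cor312Of ↔ (((I.X.l : ℝ) + 1) / 24 - 1 / (2 * (I.X.l : ℝ))) * FinDivisor.ndeg ℚ I.X.qDivisor ≤
      ThetaVolumeInput.archLogTheta I.l := by
  rw [cor312Of_rat_iff, DHData.ndegLgp_thetaPilot_eq, PilotData.qPilot_eq_smul, map_smul, smul_eq_mul]
  change _ ≤ ThetaVolumeInput.archLogTheta I.X.l ↔ _ ≤ ThetaVolumeInput.archLogTheta I.X.l
  constructor <;> intro h <;> nlinarith

/-- `κ_l·(l² + l − 12) = …`: the shallow bound solved for `deĝ̲(𝔮)` — `κ_l·N ≤ ((l+5)/4)·log π ↔ N ≤ (6l(l+5)/(l²+l−12))·log π`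
(`κ_l = (l² + l − 12)/(24l) > 0` for `l ≥ 5`). [cite: DupuyHilado2025, §3.3] -/
theorem kappa_mul_le_iff {l : ℕ} (h5 : 5 ≤ l) (N : ℝ) :
    (((l : ℝ) + 1) / 24 - 1 / (2 * (l : ℝ))) * N ≤ ((l : ℝ) + 5) / 4 * Real.log Real.pi ↔
      N ≤ 6 * (l : ℝ) * ((l : ℝ) + 5) / ((l : ℝ) ^ 2 + l - 12) * Real.log Real.pi := by
  have hl : (5 : ℝ) ≤ l := by exact_mod_cast h5
  have hl0 : (0 : ℝ) < l := by linarith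
  have hden : (0 : ℝ) < (l : ℝ) ^ 2 + l - 12 := by nlinarith
  have hk : ((l : ℝ) + 1) / 24 - 1 / (2 * (l : ℝ)) = ((l : ℝ) ^ 2 + l - 12) / (24 * l) := by
    field_simp
    ring
  have hR : 6 * (l : ℝ) * ((l : ℝ) + 5) / ((l : ℝ) ^ 2 + l - 12) * Real.log Real.pi =
      (6 * (l : ℝ) * ((l : ℝ) + 5) * Real.log Real.pi) / ((l : ℝ) ^ 2 + l - 12) := by ring
  rw [hk, hR, le_div_iff₀ hden, div_mul_eq_mul_div, div_le_iff₀ (by positivity : (0 : ℝ) < 24 * l)]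
  have he : ((l : ℝ) + 5) / 4 * Real.log Real.pi * (24 * l) = 6 * (l : ℝ) * ((l : ℝ) + 5) * Real.log Real.pi := by
    ring
  have hc : ((l : ℝ) ^ 2 + l - 12) * N = N * ((l : ℝ) ^ 2 + l - 12) := mul_comm _ _
  constructor <;> intro h <;> linarith [he, hc]

/-- **… ⟺ `deĝ̲(𝔮) ≤ (6l(l+5)/(l²+l−12))·log π`** (for `l = 5`: `deĝ̲(𝔮) ≤ (50/3)·log π ≈ 19.08`; `l = 7`: `≤ (126/11)·log π ≈ 13.11`;
the bound decreases to `6·log π ≈ 6.87` as `l → ∞`). Over `ℚ/ℚ`, `deĝ̲(𝔮) = Σ_{v∈S} ord_v(q_v)·log p_v`.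
[cite: Mochizuki2012, IUTchIII Cor. 3.12 p. 173–174] [claim: Mochizuki2012, status: disputed] -/
theorem cor312Of_rat_iff_deg_le :
    I.Cor312Of ↔ FinDivisor.ndeg ℚ I.X.qDivisor ≤
      6 * (I.X.l : ℝ) * ((I.X.l : ℝ) + 5) / ((I.X.l : ℝ) ^ 2 + I.X.l - 12) * Real.log Real.pi := by
  rw [cor312Of_rat_iff_kappa]
  exact kappa_mul_le_iff I.X.five_le_l _

/-- **UNIFORM FAILURE over `ℚ/ℚ`**: every input with `deĝ̲(𝔮) > (50/3)·log π` (`≈ 19.08`; any `l`, any `S`, any ideles) has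
`¬ Cor312Of I` — `6l(l+5)/(l²+l−12) ≤ 50/3` for `l ≥ 5`. HYPOTHESIS-shaped; synthetic inputs; no side taken.
[cite: Mochizuki2012, IUTchIII Cor. 3.12 p. 173–174] [claim: Mochizuki2012, status: disputed] -/
theorem not_cor312Of_rat_of_lt (h : 50 / 3 * Real.log Real.pi < FinDivisor.ndeg ℚ I.X.qDivisor) : ¬ I.Cor312Of := by
  rw [cor312Of_rat_iff_deg_le, not_le]
  refine lt_of_le_of_lt ?_ h
  have hl : (5 : ℝ) ≤ I.X.l := by exact_mod_cast I.X.five_le_l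
  have hden : (0 : ℝ) < (I.X.l : ℝ) ^ 2 + I.X.l - 12 := by nlinarith
  have hπ : 0 < Real.log Real.pi := Real.log_pos (by linarith [Real.pi_gt_three])
  have hcoef : 6 * (I.X.l : ℝ) * ((I.X.l : ℝ) + 5) / ((I.X.l : ℝ) ^ 2 + I.X.l - 12) ≤ 50 / 3 := by
    rw [div_le_iff₀ hden]
    nlinarith
  exact mul_le_mul_of_nonneg_right hcoef hπ.le

/-- **UNIFORM TRUTH over `ℚ/ℚ` in the shallow window**: every input with `deĝ̲(𝔮) ≤ 6·log π` (`≈ 6.87`; any `l`) has `Cor312Of I`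
(`6 ≤ 6l(l+5)/(l²+l−12)`). [cite: Mochizuki2012, IUTchIII Cor. 3.12 p. 173–174] [claim: Mochizuki2012, status: disputed] -/
theorem cor312Of_rat_of_le (h : FinDivisor.ndeg ℚ I.X.qDivisor ≤ 6 * Real.log Real.pi) : I.Cor312Of := by
  rw [cor312Of_rat_iff_deg_le]
  refine h.trans ?_
  have hl : (5 : ℝ) ≤ I.X.l := by exact_mod_cast I.X.five_le_l
  have hden : (0 : ℝ) < (I.X.l : ℝ) ^ 2 + I.X.l - 12 := by nlinarith
  have hπ : 0 < Real.log Real.pi := Real.log_pos (by linarith [Real.pi_gt_three])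
  have hcoef : (6 : ℝ) ≤ 6 * (I.X.l : ℝ) * ((I.X.l : ℝ) + 5) / ((I.X.l : ℝ) ^ 2 + I.X.l - 12) := by
    rw [le_div_iff₀ hden]
    nlinarith
  exact mul_le_mul_of_nonneg_right hcoef hπ.le

/-- **Over `ℚ/ℚ` reading (P) attains the bare value too**: `negLogThetaPerImageNonarch I = −deĝ̲_lgp(P_Θ)` — squeezed between
c312-d1's free inequality in reading (P) (`DHData.free_inequality_perImage_input`) and `vol_(P) ≤ vol_(U)`
(`DHData.negLogThetaPerImageNonarch_le_negLogThetaNonarch`). [cite: Mochizuki2012, IUTchIII Cor. 3.12 proof Step (x) pp. 180–181]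
[cite: DupuyHilado2025, Thm. 3.10.1, §4.11–4.12] [claim: Mochizuki2012, status: disputed] -/
theorem negLogThetaPerImageNonarch_rat_eq : I.negLogThetaPerImageNonarch = -LgpDivisor.ndegLgp I.X.thetaPilot :=
  le_antisymm ((DHData.negLogThetaPerImageNonarch_le_negLogThetaNonarch I).trans (negLogThetaNonarch_rat_eq I).le)
    (DHData.free_inequality_perImage_input I)

/-- **Over `ℚ/ℚ` the readings (U) and (P) COINCIDE for every input**: `Cor312PerImageOf I ↔ Cor312Of I` (both are the bare-value
inequality `deĝ̲_lgp(P_Θ) − deĝ̲(P_q) ≤ ((l+5)/4)·log π`). [cite: Mochizuki2012, IUTchIII Cor. 3.12 p. 173–174] [claim: Mochizuki2012, status: disputed] -/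
theorem cor312PerImageOf_rat_iff_cor312Of : I.Cor312PerImageOf ↔ I.Cor312Of := by
  unfold ThetaVolumeInput.Cor312PerImageOf ThetaVolumeInput.Cor312Of ThetaVolumeInput.negLogThetaPerImage
    ThetaVolumeInput.negLogTheta
  rw [negLogThetaPerImageNonarch_rat_eq, negLogThetaNonarch_rat_eq]

end RatInputs

end Summit.ABC.IUTFork.GenuineContent

end
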